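/-
Copyright: public-domain mathematics; typed transcription for the H21 Literature library (cell pub-balaban, PAPER SUB-CELL B05 gen 5).

# Bałaban, *Propagators and renormalization transformations for lattice gauge theories. I*,
# Commun. Math. Phys. **95** (1984) 17–40 — a `C^{1,1}` partition of unity (1.118) on the finite torus with second
# differences `O(M₀⁻²)` (the `(Δh)A` datum of (1.121)), and (1.128) for it

[cite: Balaban1984PropagatorsI]  T. Bałaban, Commun. Math. Phys. 95 (1984) 17–40 (= B5 of the series), p. 36
(PDF page 20), display (1.118); p. 37 (PDF 21), display (1.121); p. 38 (PDF 22), display (1.128).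

WHAT THIS MODULE IS.  Fourth module of gen 5 (after `B5TorusCover`, `B5TorusPartition`, `B5Commutator128`); it
closes the cell's self-located gap G-B5-28a at the level of the partition functions.  The printed support is the
sentence of p. 36 quoted (in full, and certified) in the headers of `B5Local114` and `B5TorusPartition`:

  "We construct a partition of unity taking the functions `h_z(x) = Π_{μ=1}^d h((x_μ − z_μ)/M₀)`,
  `h ∈ C₀^∞(]−⅔, ⅔[)`, `h(t) = 1` for `t ∈ [−⅓, ⅓]`, h is chosen in such a way that `Σ_n h²(t − n) = 1`, hence
  `Σ_z h_z²(x) = 1`.  (1.118)"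

and the commutator formula (1.121) p. 37 (transcribed as in the header of `B5Local114`, which certifies it):
`Δ_a hA = (Δ − ∂P∂* + aQ*Q)hA = hΔ_aA − [Σ_{b∈st(·)} (∂h)(b)(∂A)(b) − (Δh)A + S*(∂h)QA − Q*S(∂h)A + P₁(∂h)A]
= hΔ_aA − K(h)A`, whose term `(Δh)A` (inside the bracket `K(h)A`) consumes SECOND differences of `h_z`.
`B5TorusPartition` delivers a
partition of unity with Lipschitz (`C^{0,1}`) profiles only — enough for the `∂h`-terms, NOT for `(Δh)A` on a fine
lattice `T_η` (a kink costs `O(M₀⁻¹η⁻¹)`; gap G-B5-28a, DIVERGENCE D-b05g5.2 (iii)).  THIS FILE constructs, for all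
periods `N_i` DIVISIBLE by `M₀` and `≥ 2M₀` (print: `M₀ = L^{m₀}` divides the period), a partition of unity
`hS_z(x) = Π_μ gS_{z_μ}(x_μ)` over the same centre set `B5TorusCover.Ctr N M₀` whose profiles are `C^{1,1}`:
`gS_k(t) = cos(½π·σ(dist(t, M₀k + Nℤ)/M₀))` with the clamped cubic step `σ(y) = 3m² − 2m³`, `m = min{y, 1}`
(`σ(0) = 0`, `σ(1) = 1`, `σ′(0) = σ′(1) = 0`, `σ(1 − y) = 1 − σ(y)`).  Under `M₀ ∣ N` every residue `t` sees exactly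
two centres at distance `< M₀`, at distances `r = t mod M₀` and `M₀ − r`, so `Σ_k gS_k(t)² = cos²(½πσ(y)) +
cos²(½πσ(1 − y)) = cos² + sin² = 1` EXACTLY (`y = r/M₀`) — no normalisation, hence no `√`-calculus in the second
differences.

§1 (folklore real analysis).  `cstep`/`cstepD` (the clamped cubic step and its derivative `6m(1 − m)`): values,
symmetry `cstep_symm`, `|σ′| ≤ 6(1 − min{y,1})`, Lipschitz `|σ(y′) − σ(y)| ≤ 2|y′ − y|`, and the `C^{1,1}` Taylor
bound `cstep_taylor : |σ(y′) − σ(y) − σ′(y)(y′ − y)| ≤ 3(y′ − y)²` (`y, y′ ≥ 0`); the profile `cprof = cos(½π·σ)`: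
`cprof 0 = 1`, `cprof = 0` on `[1, ∞)`, `0 ≤ cprof ≤ 1`, `cprof(y)² + cprof(1 − y)² = 1` on `[0, 1]`
(`cprof_sq_add`), Lipschitz constant 4, and the three-term cosine estimate
`abs_cos_second_diff_le : |cos A − 2cos B + cos C| ≤ |A − 2B + C| + |C − A|·|C − B|/2`.

§2 (one circle, integer arithmetic).  `circAbs_three`: for `N ≥ 2` and consecutive integers `a, a+1, a+2` with
circular distances `c₀, c₁, c₂`: `c₀ + c₂ = 2c₁ ∨ c₁ = 0 ∨ N − 2 ≤ 2c₁` (the discrete second difference of the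
distance vanishes except at the centre and at the antipode); `two_le_nC`, `mul_nC_eq` (`M₀·⌊N/M₀⌋ = N` under
`M₀ ∣ N`), `circAbs_of_rep`, and the TWO-TERM STRUCTURE `cdist_two_term` (centres `k₀ = ⌊t/M₀⌋` at distance `r`,
`k₁ = k₀ + 1 mod N/M₀` at distance `M₀ − r`, `k₀ ≠ k₁`, all others at distance `≥ M₀`).

§3 (the 1-D profile `gS`).  `0 ≤ gS ≤ 1`; SUPPORT `gS_k(t) = 0` once `dist(t, M₀k) ≥ M₀` (radius `M₀`: the
cube `□_z` of side `2M₀`; print: `⅔M₀`); `sum_gS_sq : Σ_k gS_k(t)² = 1`; LIPSCHITZ `abs_gS_sub_le : |gS_k(t) − gS_k(t′)| ≤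
(4/M₀)·dist(t − t′, Nℤ)`; and SECOND DIFFERENCES `abs_gS_second_diff_le : |gS_k(t+2) − 2gS_k(t+1) + gS_k(t)| ≤
52/M₀²` (forward form, `2M₀ ≤ N`; via `circAbs_three`, `cstep_taylor`, `abs_cos_second_diff_le`).

§4 (the torus).  `hS z x = Π_i gS (z_i) (x_i)`: `sum_hS_sq` (= (1.118), exact), `0 ≤ hS ≤ 1`, support
`hS_eq_zero_of_le` (`tdist x (ctr z) ≥ M₀ ⇒ hS_z(x) = 0`), Lipschitz `abs_hS_sub_le` (`4d/M₀` in `tdist`), and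
`abs_hS_second_diff_le`: along every axis `μ`, `|hS_z(x + 2e_μ) − 2hS_z(x + e_μ) + hS_z(x)| ≤ 52/M₀²`
(`x + e_μ := Function.update x μ (x μ + 1)`).

§5 (realisation, same shape as `B5TorusPartition` §5).  `hSU`, `HSop z := mulOp (hS_z ∘ π)` on `EuclideanSpace ℝ ι`
for any base map `π : ι → UT N`: `h118S_holds : Σ_z HSop z * HSop z = 1` (field `h118` of `B5Local114.Realisation`),
`symmHS_holds`, `norm_HSop_le`, `HSop_eq_zero_of_far` (radius `M₀`), `hSU_lipschitz`, `hSU_second_diff`,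
`hSU_mem_Icc`, `sum_hSU_sq`.

§6 ((1.128) for the smooth partition).  `h128S_torus` = `B5Commutator128.h128_schema` instantiated with
`a z i := hS_z(π i)`, support radius `s := M₀`, Lipschitz constant `ℓ := 4d/M₀`: GIVEN the split
`Δ_a = kerOp l + kerOp k` (`l` of range `ρ` with normed local commutator bound `ℓ₁` — (1.121); `k` with the decay
(1.126)), the bound (1.128) with rate `twoDelta0 δ M₀ = min{⅓δ, M₀⁻¹}` and constant `ℓ₁e^{4+ρ/M₀} +
(4d/M₀)·C·(24/(eδ))·Λ·e⁷`; `h128S_torus_fibre` discharges the row sum through a base map with fibres `≤ m`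
(`B5Commutator128.rowsum_fibre_le`).  The remaining hypotheses are exactly the cell's G-B5-29 (a)–(c): the split,
the local bound (1.121) (for which THIS module now supplies both data, `∇h = O(M₀⁻¹)` and `Δh = O(M₀⁻²)`, but whose
operator form — `Δ_a`, `Q`, `S`, `P` on `T_η` — is not formalised at this level), and the decay (1.126).

THE FINE-TORUS READING (cf. the dictionary in the header of `B5Commutator128`).  On `T_η` (`η = L^{−k}`) one
instantiates with periods in fine steps and cube size `M₀/η` fine steps: the per-axis second difference per fine step
is `≤ 52/(M₀/η)² = 52η²/M₀²`, so `|Δ^η hS_z| = η⁻²·|Σ_μ (second differences)| ≤ 52d/M₀²` and `|∇^η hS_z| ≤ 4d/M₀`,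
both UNIFORM in `η` — the regularity (1.121)/(1.128) consume.

DIVERGENCES (cell DIVERGENCE.md, D-b05g5.4).  (i) MODEL PROFILE: `cos(½π·σ(·))` with a cubic step is `C^{1,1}`, not
Bałaban's `h ∈ C₀^∞`, and it has NO plateau (`h = 1` on `[−⅓, ⅓]` in print; here `gS_k = 1` only at the centre) —
no consumer in the tree uses the plateau; support = the cube `□_z` itself (circular sup-distance `< M₀` from the
centre, side `2M₀`), which is HALF the support radius of `B5TorusPartition.hz` but LARGER than print's: with
`h ∈ C₀^∞(]−⅔, ⅔[)` the printed `h_z` is supported within `⅔M₀` of `z` in each coordinate, a margin `M₀/3` inside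
`□_z` (consumers in the tree carry the support radius as a free constant, `κ.cbar` of `B5Local114.Consts`).  (ii) HYPOTHESES `M₀ ∣ N_i` and
`2M₀ ≤ N_i` (print: `M₀ = L^{m₀}` and the periods are powers of `L`, so divisibility holds there; `B5TorusPartition`
needs neither but is only Lipschitz).  (iii) Second differences are certified in FORWARD form along coordinate axes
with the unoptimised constant `52`; mixed second differences are not needed for `Δ^η` and not provided.  (iv) Sup
circular distance throughout (D-b05g5.1 (ii)).

v1.1 (same seat, 2026-08-18/19): docstring-only DOCFIX D1 of the cross-read C-pv07-21 (the header's transcription of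
(1.121) restored to the printed bracketed form with `Δ_a`; v1 had dropped the bracket, inverting the signs of four
`K(h)A` terms) and precision R1 (printed support radius `⅔M₀`) in DIVERGENCES (i); no declaration changed (v1 = p181245).

HONEST LABELLING.  Nothing here is a claim of the paper beyond the quoted sentence and the displayed formula; every
statement is kernel-proved; decls marked MODEL are this library's constructions, decls marked [folklore] are
elementary.  Imports: `B5TorusPartition` (circle distance `cdist`, `mulOp`), `B5Commutator128` (§6 only) and Mathlib.
value = kernel certificate of a located leaf (the partition-of-unity data of (1.118)/(1.121): Σh² = 1, support,
∇h = O(M₀⁻¹), Δh = O(M₀⁻²), uniformly in the torus) — NOT summit progress.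
-/
import Mathlib
import Literature.MathematicalPhysics.QuantumFieldTheory.Balaban1983to89.B5TorusPartition
import Literature.MathematicalPhysics.QuantumFieldTheory.Balaban1983to89.B5Commutator128

open Finset

namespace Literature.MathematicalPhysics.QuantumFieldTheory.Balaban1983to89.B5SmoothPartition

open B4TorusKernel.MultiPeriod (circAbs circAbs_nonneg circAbs_le_abs circAbs_add_mul)
open B4Sect5Torus (TSite ccoord tdist tdist_nonneg circAbs_le_tdist ccoord_cast)
open B5TorusCover (nC one_le_nC nC_eq_div Ctr ctr ctr_val ctr_lt UT ctrU)
open B5Commutator128 (kerOp Schema h128_schema rowsum_fibre_le)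
open B5Local114 (Kop)
open B5Walk131 (twoDelta0)
open B5TorusPartition (cdist cdist_nonneg abs_cdist_sub_le abs_circAbs_sub_circAbs_le ccoord_ctr_eq abs_prod_sub_prod_le mulOp mulOp_apply
  sum_mulOp_mul_self mulOp_eq_zero_of_vanish norm_mulOp_le inner_mulOp_left)

noncomputable section

/-! ## §1  Folklore: the clamped cubic step, its cosine profile, and a trigonometric second-difference bound -/

section Folklore

/-- The clamped cubic step `σ(y) = 3m² − 2m³`, `m = min{y, 1}` (`σ = 0` at `0`, `σ = 1` on `[1, ∞)`, `σ′(0) = σ′(1) = 0`).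
[folklore] -/
def cstep (y : ℝ) : ℝ := 3 * min y 1 ^ 2 - 2 * min y 1 ^ 3

/-- Its derivative `σ′(y) = 6m(1 − m)`, `m = min{y, 1}` (a plain function; no `deriv` is used). [folklore] -/
def cstepD (y : ℝ) : ℝ := 6 * min y 1 * (1 - min y 1)

/-- `σ` below `1`. [folklore] -/
theorem cstep_of_le_one {y : ℝ} (h : y ≤ 1) : cstep y = 3 * y ^ 2 - 2 * y ^ 3 := by
  unfold cstep; rw [min_eq_left h]

/-- `σ = 1` on `[1, ∞)`. [folklore] -/
theorem cstep_of_one_le {y : ℝ} (h : 1 ≤ y) : cstep y = 1 := by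
  unfold cstep; rw [min_eq_right h]; norm_num

/-- `σ′` below `1`. [folklore] -/
theorem cstepD_of_le_one {y : ℝ} (h : y ≤ 1) : cstepD y = 6 * y * (1 - y) := by
  unfold cstepD; rw [min_eq_left h]

/-- `σ′ = 0` on `[1, ∞)`. [folklore] -/
theorem cstepD_of_one_le {y : ℝ} (h : 1 ≤ y) : cstepD y = 0 := by
  unfold cstepD; rw [min_eq_right h]; ring

/-- `σ(0) = 0`. [folklore] -/
theorem cstep_zero : cstep 0 = 0 := by
  rw [cstep_of_le_one zero_le_one]; norm_num

/-- `σ′(0) = 0` (flatness at the centre). [folklore] -/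
theorem cstepD_zero : cstepD 0 = 0 := by
  rw [cstepD_of_le_one zero_le_one]; ring

/-- `0 ≤ σ` on `[0, ∞)`. [folklore] -/
theorem cstep_nonneg {y : ℝ} (hy : 0 ≤ y) : 0 ≤ cstep y := by
  unfold cstep
  have h0 : 0 ≤ min y 1 := le_min hy zero_le_one
  have h1 : min y 1 ≤ 1 := min_le_right _ _
  nlinarith [mul_nonneg (mul_nonneg h0 h0) (by linarith : (0 : ℝ) ≤ 3 - 2 * min y 1)]

/-- `σ ≤ 1` on `[0, ∞)` (`1 − σ = (1 − m)²(1 + 2m)`). [folklore] -/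
theorem cstep_le_one {y : ℝ} (hy : 0 ≤ y) : cstep y ≤ 1 := by
  unfold cstep
  have h0 : 0 ≤ min y 1 := le_min hy zero_le_one
  have h1 : 0 ≤ 1 - min y 1 := sub_nonneg.mpr (min_le_right _ _)
  nlinarith [mul_nonneg (mul_nonneg h1 h1) (by linarith : (0 : ℝ) ≤ 1 + 2 * min y 1)]

/-- **Complementarity** `σ(1 − y) = 1 − σ(y)` on `[0, 1]`. [folklore] -/
theorem cstep_symm {y : ℝ} (h0 : 0 ≤ y) (h1 : y ≤ 1) : cstep (1 - y) = 1 - cstep y := by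
  rw [cstep_of_le_one (by linarith), cstep_of_le_one h1]; ring

/-- `|σ′| ≤ 6(1 − m)`: `σ′` vanishes to first order at the outer edge `y = 1`. [folklore] -/
theorem abs_cstepD_le {y : ℝ} (hy : 0 ≤ y) : |cstepD y| ≤ 6 * (1 - min y 1) := by
  unfold cstepD
  have h0 : 0 ≤ min y 1 := le_min hy zero_le_one
  have h1 : 0 ≤ 1 - min y 1 := sub_nonneg.mpr (min_le_right _ _)
  rw [abs_of_nonneg (by positivity)]
  nlinarith [mul_nonneg h1 (sub_nonneg.mpr (min_le_right y 1))]

/-- **`σ` is `2`-Lipschitz on `[0, ∞)`.** [folklore] -/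
theorem abs_cstep_sub_le {y y' : ℝ} (hy : 0 ≤ y) (hy' : 0 ≤ y') : |cstep y' - cstep y| ≤ 2 * |y' - y| := by
  have hm : |min y' 1 - min y 1| ≤ |y' - y| := by
    have := abs_min_sub_min_le_max y' 1 y 1
    rwa [sub_self, abs_zero, max_eq_left (abs_nonneg _)] at this
  have h0 : 0 ≤ min y 1 := le_min hy zero_le_one
  have h1 : min y 1 ≤ 1 := min_le_right _ _
  have h0' : 0 ≤ min y' 1 := le_min hy' zero_le_one
  have h1' : min y' 1 ≤ 1 := min_le_right _ _
  set m := min y 1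
  set m' := min y' 1
  have e : cstep y' - cstep y = (m' - m) * (3 * (m' + m) - 2 * (m' ^ 2 + m' * m + m ^ 2)) := by
    unfold cstep; ring
  have hF : |3 * (m' + m) - 2 * (m' ^ 2 + m' * m + m ^ 2)| ≤ 2 := by
    rw [abs_le]
    constructor
    · nlinarith [mul_nonneg h0 h0', mul_nonneg h0 h0, mul_nonneg h0' h0']
    · nlinarith [sq_nonneg (m' - m), sq_nonneg (m' + m - 1)]
  rw [e, abs_mul]
  calc |m' - m| * |3 * (m' + m) - 2 * (m' ^ 2 + m' * m + m ^ 2)| ≤ |y' - y| * 2 :=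
        mul_le_mul hm hF (abs_nonneg _) (abs_nonneg _)
    _ = 2 * |y' - y| := mul_comm _ _

/-- **`C^{1,1}` Taylor bound** `|σ(y′) − σ(y) − σ′(y)(y′ − y)| ≤ 3(y′ − y)²` on `[0, ∞)` (the Lipschitz constant of
`σ′` is `6`). [folklore] -/
theorem cstep_taylor {y y' : ℝ} (hy : 0 ≤ y) (hy' : 0 ≤ y') :
    |cstep y' - cstep y - cstepD y * (y' - y)| ≤ 3 * (y' - y) ^ 2 := by
  rcases le_total y 1 with h1 | h1 <;> rcases le_total y' 1 with h1' | h1'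
  · -- both in `[0, 1]`: exact cubic Taylor remainder `(y′−y)²(3 − 4y − 2y′)`
    rw [cstep_of_le_one h1, cstep_of_le_one h1', cstepD_of_le_one h1]
    have e : 3 * y' ^ 2 - 2 * y' ^ 3 - (3 * y ^ 2 - 2 * y ^ 3) - 6 * y * (1 - y) * (y' - y)
        = (y' - y) ^ 2 * (3 - 4 * y - 2 * y') := by ring
    rw [e, abs_mul, abs_of_nonneg (sq_nonneg _), mul_comm]
    exact mul_le_mul_of_nonneg_right (abs_le.mpr ⟨by linarith, by linarith⟩) (sq_nonneg _)
  · -- `y ≤ 1 ≤ y′`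
    rw [cstep_of_le_one h1, cstep_of_one_le h1', cstepD_of_le_one h1]
    have ha : 0 ≤ 1 - y := by linarith
    have hb : 0 ≤ y' - 1 := by linarith
    rw [abs_le]
    constructor
    · nlinarith [mul_nonneg ha hb, mul_nonneg (mul_nonneg ha ha) hy, mul_nonneg (mul_nonneg ha hb) hy,
        mul_nonneg hb hb]
    · nlinarith [mul_nonneg ha hb, mul_nonneg (mul_nonneg ha ha) ha, mul_nonneg (mul_nonneg ha hb) ha,
        mul_nonneg hb hb, mul_nonneg (mul_nonneg ha ha) hy, mul_nonneg (mul_nonneg ha hb) hy]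
  · -- `y′ ≤ 1 ≤ y`
    rw [cstep_of_one_le h1, cstep_of_le_one h1', cstepD_of_one_le h1]
    have ha : 0 ≤ 1 - y' := by linarith
    have e : 3 * y' ^ 2 - 2 * y' ^ 3 - 1 - 0 * (y' - y) = -((1 - y') ^ 2 * (1 + 2 * y')) := by ring
    rw [e, abs_neg, abs_mul, abs_of_nonneg (sq_nonneg _), abs_of_nonneg (by linarith)]
    have h2 : (1 - y') ^ 2 ≤ (y' - y) ^ 2 := by nlinarith
    nlinarith [mul_nonneg (sq_nonneg (1 - y')) ha]
  · -- both `≥ 1`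
    rw [cstep_of_one_le h1, cstep_of_one_le h1', cstepD_of_one_le h1]
    simp [sq_nonneg]

/-- **The cosine profile** `U(y) = cos(½π·σ(y))`: `U(0) = 1`, `U = 0` on `[1, ∞)`, `U(y)² + U(1−y)² = 1`. [folklore] -/
def cprof (y : ℝ) : ℝ := Real.cos (Real.pi / 2 * cstep y)

/-- `U(0) = 1`. [folklore] -/
theorem cprof_zero : cprof 0 = 1 := by
  simp [cprof, cstep_zero]

/-- `U = 0` on `[1, ∞)`. [folklore] -/
theorem cprof_of_one_le {y : ℝ} (h : 1 ≤ y) : cprof y = 0 := by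
  rw [cprof, cstep_of_one_le h, mul_one, Real.cos_pi_div_two]

/-- `0 ≤ U` on `[0, ∞)`. [folklore] -/
theorem cprof_nonneg {y : ℝ} (hy : 0 ≤ y) : 0 ≤ cprof y := by
  apply Real.cos_nonneg_of_mem_Icc
  constructor
  · have := mul_nonneg (div_nonneg Real.pi_pos.le zero_le_two) (cstep_nonneg hy)
    linarith [Real.pi_pos]
  · have := mul_le_mul_of_nonneg_left (cstep_le_one hy) (div_nonneg Real.pi_pos.le zero_le_two)
    linarith

/-- `U ≤ 1`. [folklore] -/
theorem cprof_le_one (y : ℝ) : cprof y ≤ 1 := Real.cos_le_one _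

/-- **Exact complementarity** `U(y)² + U(1 − y)² = 1` on `[0, 1]` (`cos² + sin²`). [folklore] -/
theorem cprof_sq_add {y : ℝ} (h0 : 0 ≤ y) (h1 : y ≤ 1) : cprof y ^ 2 + cprof (1 - y) ^ 2 = 1 := by
  unfold cprof
  rw [cstep_symm h0 h1, show Real.pi / 2 * (1 - cstep y) = Real.pi / 2 - Real.pi / 2 * cstep y by ring,
    Real.cos_pi_div_two_sub]
  exact Real.cos_sq_add_sin_sq _

/-- **`U` is `4`-Lipschitz on `[0, ∞)`** (`|cos a − cos b| ≤ |a − b|`, `½π·2 < 4`). [folklore] -/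
theorem abs_cprof_sub_le {y y' : ℝ} (hy : 0 ≤ y) (hy' : 0 ≤ y') : |cprof y' - cprof y| ≤ 4 * |y' - y| := by
  unfold cprof
  refine (Real.abs_cos_sub_cos_le _ _).trans ?_
  rw [← mul_sub, abs_mul, abs_of_pos (div_pos Real.pi_pos two_pos)]
  have h := abs_cstep_sub_le hy hy'
  have hπ : Real.pi / 2 ≤ 2 := by linarith [Real.pi_le_four]
  calc Real.pi / 2 * |cstep y' - cstep y| ≤ 2 * (2 * |y' - y|) :=
        mul_le_mul hπ h (abs_nonneg _) zero_le_two
    _ = 4 * |y' - y| := by ring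

/-- **Trigonometric second-difference bound**: for all real `A, B, C`,
`|cos A − 2cos B + cos C| ≤ |A − 2B + C| + |C − A|·|C − B|/2` (sum-to-product formulas and `|sin x| ≤ |x|`,
`|sin x| ≤ 1`; no derivatives). [folklore] -/
theorem abs_cos_second_diff_le (A B C : ℝ) :
    |Real.cos A - 2 * Real.cos B + Real.cos C| ≤ |A - 2 * B + C| + |C - A| * |C - B| / 2 := by
  have h1 := Real.cos_sub_cos A B
  have h2 := Real.cos_sub_cos C B
  set S₁ := Real.sin ((A + B) / 2)
  set S₂ := Real.sin ((C + B) / 2)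
  set p := (A - B) / 2
  set q := (C - B) / 2
  have e : Real.cos A - 2 * Real.cos B + Real.cos C
      = -2 * (S₁ * (Real.sin p + Real.sin q) + (S₂ - S₁) * Real.sin q) := by
    have : Real.cos A - 2 * Real.cos B + Real.cos C = (Real.cos A - Real.cos B) + (Real.cos C - Real.cos B) := by
      ring
    rw [this, h1, h2]; ring
  -- `|sin p + sin q| ≤ |p + q|`
  have hpq : |Real.sin p + Real.sin q| ≤ |p + q| := by
    have hs := Real.sin_sub_sin p (-q)
    rw [Real.sin_neg, sub_neg_eq_add] at hs
    rw [hs, abs_mul, abs_mul, abs_two]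
    calc 2 * |Real.sin ((p - -q) / 2)| * |Real.cos ((p + -q) / 2)| ≤ 2 * |(p - -q) / 2| * 1 := by
          apply mul_le_mul (mul_le_mul_of_nonneg_left Real.abs_sin_le_abs zero_le_two) (Real.abs_cos_le_one _)
            (abs_nonneg _) (by positivity)
      _ = |p + q| := by rw [sub_neg_eq_add, abs_div, abs_two]; ring
  -- `|S₂ − S₁| ≤ |C − A|/2`
  have hS : |S₂ - S₁| ≤ |C - A| / 2 := by
    have hs := Real.sin_sub_sin ((C + B) / 2) ((A + B) / 2)
    change S₂ - S₁ = _ at hs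
    rw [hs, abs_mul, abs_mul, abs_two]
    calc 2 * |Real.sin (((C + B) / 2 - (A + B) / 2) / 2)| * |Real.cos (((C + B) / 2 + (A + B) / 2) / 2)|
        ≤ 2 * |((C + B) / 2 - (A + B) / 2) / 2| * 1 := by
          apply mul_le_mul (mul_le_mul_of_nonneg_left Real.abs_sin_le_abs zero_le_two) (Real.abs_cos_le_one _)
            (abs_nonneg _) (by positivity)
      _ = |C - A| / 2 := by
          rw [show ((C + B) / 2 - (A + B) / 2) / 2 = (C - A) / 4 by ring, abs_div]
          rw [show |(4 : ℝ)| = 4 by norm_num]; ring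
  have hq : |Real.sin q| ≤ |C - B| / 2 := by
    refine Real.abs_sin_le_abs.trans (le_of_eq ?_)
    rw [show q = (C - B) / 2 from rfl, abs_div, abs_two]
  have hS₁ : |S₁| ≤ 1 := Real.abs_sin_le_one _
  have hpq' : |p + q| = |A - 2 * B + C| / 2 := by
    rw [show p + q = (A - 2 * B + C) / 2 by simp only [p, q]; ring, abs_div, abs_two]
  rw [e, abs_mul, show |(-2 : ℝ)| = 2 by norm_num]
  have hin : |S₁ * (Real.sin p + Real.sin q) + (S₂ - S₁) * Real.sin q|
      ≤ |A - 2 * B + C| / 2 + |C - A| / 2 * (|C - B| / 2) := by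
    refine (abs_add_le _ _).trans ?_
    rw [abs_mul, abs_mul]
    have t1 : |S₁| * |Real.sin p + Real.sin q| ≤ 1 * (|A - 2 * B + C| / 2) :=
      mul_le_mul hS₁ (hpq.trans (le_of_eq hpq')) (abs_nonneg _) zero_le_one
    have t2 : |S₂ - S₁| * |Real.sin q| ≤ |C - A| / 2 * (|C - B| / 2) :=
      mul_le_mul hS hq (abs_nonneg _) (by positivity)
    linarith
  calc 2 * |S₁ * (Real.sin p + Real.sin q) + (S₂ - S₁) * Real.sin q|
      ≤ 2 * (|A - 2 * B + C| / 2 + |C - A| / 2 * (|C - B| / 2)) := by linarith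
    _ = |A - 2 * B + C| + |C - A| * |C - B| / 2 := by ring

end Folklore

/-! ## §2  Circle arithmetic: three consecutive circular distances; the two-term structure under `M₀ ∣ N` -/

section Circle

variable {N M₀ : ℕ}

/-- **Three consecutive circular distances.** For `N ≥ 2` and `a ∈ ℤ`, with `c_j = dist(a + j, Nℤ)`: either
`c₀ + c₂ = 2c₁` (no reflection inside the triple), or `c₁ = 0` (the middle point is the centre), or `2c₁ ≥ N − 2`
(the triple sits at the antipode). [folklore] -/
theorem circAbs_three (hN : 2 ≤ N) (a : ℤ) :
    circAbs N a + circAbs N (a + 2) = 2 * circAbs N (a + 1) ∨ circAbs N (a + 1) = 0 ∨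
      (N : ℤ) - 2 ≤ 2 * circAbs N (a + 1) := by
  have hN0 : (0 : ℤ) < N := by exact_mod_cast (by omega : 0 < N)
  set r := (a + 1) % (N : ℤ) with hr
  have hr0 : 0 ≤ r := Int.emod_nonneg _ hN0.ne'
  have hrN : r < N := Int.emod_lt_of_pos _ hN0
  have h2 : (a + 2) % (N : ℤ) = if r + 1 < N then r + 1 else 0 := by
    rw [show a + 2 = (a + 1) + 1 by ring, ← Int.emod_add_emod, ← hr]
    split_ifs with h
    · exact Int.emod_eq_of_lt (by linarith) h
    · rw [show r + 1 = N by omega, Int.emod_self]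
  have h0 : a % (N : ℤ) = if r = 0 then (N : ℤ) - 1 else r - 1 := by
    rw [show a = (a + 1) + (-1) by ring, ← Int.emod_add_emod, ← hr]
    split_ifs with h
    · rw [h, zero_add, show (-1 : ℤ) = ((N : ℤ) - 1) + (N : ℤ) * (-1) by ring, Int.add_mul_emod_self_left]
      exact Int.emod_eq_of_lt (by linarith) (by linarith)
    · exact Int.emod_eq_of_lt (by omega) (by omega)
  unfold circAbs
  rw [h2, h0, ← hr]
  split_ifs <;> omega

/-- Under `2M₀ ≤ N` (and `M₀ ≥ 1`) there are `nC N M₀ = ⌊N/M₀⌋ ≥ 2` centres. [folklore] -/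
theorem two_le_nC (hM : 1 ≤ M₀) (h2N : 2 * M₀ ≤ N) : 2 ≤ nC N M₀ := by
  have h : 2 ≤ N / M₀ := (Nat.le_div_iff_mul_le (by omega)).mpr h2N
  rwa [nC_eq_div (le_trans one_le_two h)]

/-- Under `M₀ ∣ N`, `2M₀ ≤ N`: `M₀ · nC N M₀ = N` (equally spaced centres `M₀k`, `k < N/M₀`). [folklore] -/
theorem mul_nC_eq (hM : 1 ≤ M₀) (hdiv : M₀ ∣ N) (h2N : 2 * M₀ ≤ N) : M₀ * nC N M₀ = N := by
  have h : 2 ≤ N / M₀ := (Nat.le_div_iff_mul_le (by omega)).mpr h2N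
  rw [nC_eq_div (le_trans one_le_two h)]
  exact Nat.mul_div_cancel' hdiv

/-- Circular distance of a residue with representative `M₀δ + r` (`δ < n`, `r < M₀`, `N = M₀n`):
`dist(M₀δ + r + Nc, Nℤ) = min{M₀δ + r, N − M₀δ − r}`. [folklore] -/
theorem circAbs_of_rep {n δ r : ℕ} (hNn : N = M₀ * n) (hδ : δ < n) (hr : r < M₀) {x : ℤ} (c : ℤ)
    (hx : x = ((M₀ * δ + r : ℕ) : ℤ) + (N : ℤ) * c) :
    circAbs N x = min (((M₀ * δ + r : ℕ) : ℤ)) ((N : ℤ) - ((M₀ * δ + r : ℕ) : ℤ)) := by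
  have hlt : M₀ * δ + r < N := by
    have h1 : M₀ * (δ + 1) ≤ M₀ * n := Nat.mul_le_mul_left _ (Nat.succ_le_of_lt hδ)
    rw [hNn]
    linarith [mul_add M₀ δ 1, mul_one M₀]
  rw [hx, circAbs_add_mul]
  unfold circAbs
  rw [Int.emod_eq_of_lt (by positivity) (by exact_mod_cast hlt)]

/-- **The two-term structure of the equally spaced cover** (`M₀ ∣ N`, `2M₀ ≤ N`): for every residue `t`, with
`r = t mod M₀`, the centre `k₀ = ⌊t/M₀⌋` is at circular distance `r`, the next centre `k₁ = k₀ + 1 (mod N/M₀)` at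
distance `M₀ − r`, `k₀ ≠ k₁`, and every other centre is at distance `≥ M₀`. [folklore] -/
theorem cdist_two_term (hM : 1 ≤ M₀) (hdiv : M₀ ∣ N) (h2N : 2 * M₀ ≤ N) (t : Fin N) :
    ∃ k₀ k₁ : Fin (nC N M₀), k₀ ≠ k₁ ∧
      cdist N M₀ k₀ t = ((t.val % M₀ : ℕ) : ℝ) ∧ cdist N M₀ k₁ t = (M₀ : ℝ) - ((t.val % M₀ : ℕ) : ℝ) ∧
      ∀ k : Fin (nC N M₀), k ≠ k₀ → k ≠ k₁ → (M₀ : ℝ) ≤ cdist N M₀ k t := by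
  have hn2 : 2 ≤ nC N M₀ := two_le_nC hM h2N
  have hNn : N = M₀ * nC N M₀ := (mul_nC_eq hM hdiv h2N).symm
  set n := nC N M₀ with hn_def
  -- `q = ⌊t/M₀⌋`, `r = t mod M₀`, `n = δ₁ + 1`
  obtain ⟨q, r, hqr, hrM, hq_def, hr_def⟩ :
      ∃ q r : ℕ, M₀ * q + r = t.val ∧ r < M₀ ∧ q = t.val / M₀ ∧ r = t.val % M₀ :=
    ⟨_, _, Nat.div_add_mod _ _, Nat.mod_lt _ (by omega), rfl, rfl⟩
  obtain ⟨δ₁, hδ₁⟩ : ∃ δ₁ : ℕ, δ₁ + 1 = n := ⟨n - 1, by omega⟩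
  have hqn : q < n := by
    by_contra h
    have h1 : M₀ * n ≤ M₀ * q := Nat.mul_le_mul_left _ (not_lt.mp h)
    have h2 : t.val < M₀ * n := hNn ▸ t.isLt
    linarith
  have hn0 : 0 < n := by omega
  -- integer facts
  have hT : (t.val : ℤ) = M₀ * q + r := by exact_mod_cast hqr.symm
  have hNz : (N : ℤ) = M₀ * n := by exact_mod_cast hNn
  have hnz : (n : ℤ) = δ₁ + 1 := by exact_mod_cast hδ₁.symm
  have hM0 : (0 : ℤ) ≤ M₀ := by positivity
  have h2Nz : 2 * (M₀ : ℤ) ≤ N := by exact_mod_cast h2N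
  have hrz : (r : ℤ) < M₀ := by exact_mod_cast hrM
  have hδ₁1 : 1 ≤ δ₁ := by omega
  have hMδ₁ : (M₀ : ℤ) ≤ M₀ * δ₁ := le_mul_of_one_le_right hM0 (by exact_mod_cast hδ₁1)
  -- (I0) the own centre
  have I0 : circAbs N ((t.val : ℤ) - ((M₀ * q : ℕ) : ℤ)) = r := by
    have hx : (t.val : ℤ) - ((M₀ * q : ℕ) : ℤ) = ((M₀ * 0 + r : ℕ) : ℤ) + (N : ℤ) * 0 := by
      push_cast; linarith
    rw [circAbs_of_rep hNn hn0 hrM 0 hx]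
    push_cast
    rw [min_eq_left (by linarith)]
    ring
  -- (I1) the next centre
  have I1 : circAbs N ((t.val : ℤ) - ((M₀ * ((q + 1) % n) : ℕ) : ℤ)) = M₀ - r := by
    have key : ∃ c : ℤ, (t.val : ℤ) - ((M₀ * ((q + 1) % n) : ℕ) : ℤ) = ((M₀ * δ₁ + r : ℕ) : ℤ) + (N : ℤ) * c := by
      rcases Nat.lt_or_ge (q + 1) n with h1 | h1
      · refine ⟨-1, ?_⟩
        rw [Nat.mod_eq_of_lt h1]
        push_cast
        rw [hT, hNz, hnz]
        ring
      · have hq1 : q + 1 = n := by omega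
        refine ⟨0, ?_⟩
        rw [hq1, Nat.mod_self]
        have hqδ : (q : ℤ) = δ₁ := by exact_mod_cast (by omega : q = δ₁)
        push_cast
        rw [hT, hqδ]
        ring
    obtain ⟨c, hc⟩ := key
    rw [circAbs_of_rep hNn (by omega) hrM c hc]
    push_cast
    have hring : (M₀ : ℤ) * (δ₁ + 1) = M₀ * δ₁ + M₀ := by ring
    rw [hNz, hnz, min_eq_right (by linarith)]
    ring
  -- (I2) all other centres
  have I2 : ∀ j : ℕ, j < n → j ≠ q → j ≠ (q + 1) % n →
      (M₀ : ℤ) ≤ circAbs N ((t.val : ℤ) - ((M₀ * j : ℕ) : ℤ)) := by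
    intro j hj hjq hjq1
    -- representative `δ = (q + n − j) mod n`, with `1 ≤ δ ≤ n − 2`
    obtain ⟨e, δ, heδ, hδn, he_def, hδ_def⟩ :
        ∃ e δ : ℕ, n * e + δ = q + n - j ∧ δ < n ∧ e = (q + n - j) / n ∧ δ = (q + n - j) % n :=
      ⟨_, _, Nat.div_add_mod _ _, Nat.mod_lt _ hn0, rfl, rfl⟩
    have he2 : e < 2 := by
      rw [he_def]
      exact (Nat.div_lt_iff_lt_mul hn0).mpr (by omega)
    have hδb : 1 ≤ δ ∧ δ + 2 ≤ n := by
      rcases Nat.lt_or_ge (q + 1) n with h1 | h1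
      · rw [Nat.mod_eq_of_lt h1] at hjq1
        interval_cases e <;> omega
      · rw [show q + 1 = n by omega, Nat.mod_self] at hjq1
        interval_cases e <;> omega
    have hx : (t.val : ℤ) - ((M₀ * j : ℕ) : ℤ) = ((M₀ * δ + r : ℕ) : ℤ) + (N : ℤ) * ((e : ℤ) - 1) := by
      have hjle : j ≤ q + n := by omega
      have heδz : (n : ℤ) * e + δ = q + n - j := by
        have := heδ
        zify [hjle] at this
        linarith
      push_cast
      rw [hT, hNz]
      linear_combination (-(M₀ : ℤ)) * heδz
    rw [circAbs_of_rep hNn hδn hrM _ hx]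
    have hδz1 : (1 : ℤ) ≤ δ := by exact_mod_cast hδb.1
    have hδz2 : (δ : ℤ) + 2 ≤ n := by exact_mod_cast hδb.2
    have hMδ : (M₀ : ℤ) ≤ M₀ * δ := le_mul_of_one_le_right hM0 hδz1
    have hMδ' : (M₀ : ℤ) * δ + 2 * M₀ ≤ M₀ * n := by
      have h1 := mul_le_mul_of_nonneg_left hδz2 hM0
      have h2 : (M₀ : ℤ) * (δ + 2) = M₀ * δ + 2 * M₀ := by ring
      linarith
    push_cast
    rw [hNz]
    have hr0 : (0 : ℤ) ≤ r := by positivity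
    exact le_min (by linarith) (by linarith)
  -- assemble
  refine ⟨⟨q, hqn⟩, ⟨(q + 1) % n, Nat.mod_lt _ hn0⟩, ?_, ?_, ?_, ?_⟩
  · intro h
    have hv : q = (q + 1) % n := by simpa using congrArg Fin.val h
    rcases Nat.lt_or_ge (q + 1) n with h1 | h1
    · rw [Nat.mod_eq_of_lt h1] at hv; omega
    · rw [show q + 1 = n by omega, Nat.mod_self] at hv; omega
  · unfold cdist
    rw [← hr_def]
    exact_mod_cast I0
  · unfold cdist
    rw [← hr_def]
    exact_mod_cast I1
  · intro k hk0 hk1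
    unfold cdist
    have hkq : k.val ≠ q := fun h => hk0 (Fin.ext h)
    have hkq1 : k.val ≠ (q + 1) % n := fun h => hk1 (Fin.ext h)
    exact_mod_cast I2 k.val k.isLt hkq hkq1

end Circle

/-! ## §3  The 1-D smooth profile `gS_k(t) = cprof(dist(t, M₀k + Nℤ)/M₀)` -/

section Profile

variable {N M₀ : ℕ}

/-- MODEL. The 1-D smooth profile centred at `M₀k`: `gS_k(t) = cos(½π · σ(dist(t, M₀k + Nℤ)/M₀))` with the
clamped cubic step `σ = cstep`; radius `M₀` (it vanishes at circular distance `≥ M₀` from its centre) — this library's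
profile in place of the printed `h((x_μ − z_μ)/M₀)`, see the header, DIVERGENCES (i). [cite: Balaban1984PropagatorsI, (1.118) p.36] -/
def gS (N M₀ : ℕ) (k : Fin (nC N M₀)) (t : Fin N) : ℝ :=
  cprof (cdist N M₀ k t / M₀)

/-- `gS ≥ 0`. [folklore] -/
theorem gS_nonneg (hN : 1 ≤ N) (M₀ : ℕ) (k : Fin (nC N M₀)) (t : Fin N) : 0 ≤ gS N M₀ k t :=
  cprof_nonneg (div_nonneg (cdist_nonneg hN M₀ k t) (Nat.cast_nonneg _))

/-- `gS ≤ 1`. [folklore] -/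
theorem gS_le_one (k : Fin (nC N M₀)) (t : Fin N) : gS N M₀ k t ≤ 1 :=
  cprof_le_one _

/-- SUPPORT: `gS_k(t) = 0` as soon as `dist(t, M₀k + Nℤ) ≥ M₀`. [folklore] -/
theorem gS_eq_zero_of_le (hM : 1 ≤ M₀) {k : Fin (nC N M₀)} {t : Fin N} (h : (M₀ : ℝ) ≤ cdist N M₀ k t) :
    gS N M₀ k t = 0 :=
  cprof_of_one_le ((one_le_div (Nat.cast_pos.mpr (by omega) : (0 : ℝ) < M₀)).mpr h)

/-- **EXACT PARTITION OF UNITY in 1-D** (`M₀ ∣ N`, `2M₀ ≤ N`): `Σ_k gS_k(t)² = 1` for every residue `t` — the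
two relevant centres contribute `cos²(½πσ(y)) + cos²(½πσ(1 − y)) = cos² + sin² = 1` (`y = (t mod M₀)/M₀`), all
other profiles vanish at `t`. [folklore] -/
theorem sum_gS_sq (hM : 1 ≤ M₀) (hdiv : M₀ ∣ N) (h2N : 2 * M₀ ≤ N) (t : Fin N) :
    ∑ k, gS N M₀ k t ^ 2 = 1 := by
  obtain ⟨k₀, k₁, hne, h0, h1, hrest⟩ := cdist_two_term hM hdiv h2N t
  have hM0 : (0 : ℝ) < M₀ := Nat.cast_pos.mpr (by omega)
  rw [Fintype.sum_eq_add k₀ k₁ hne (fun k hk => by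
    rw [gS_eq_zero_of_le hM (hrest k hk.1 hk.2)]; ring)]
  unfold gS
  rw [h0, h1]
  have hr : ((t.val % M₀ : ℕ) : ℝ) < M₀ := by exact_mod_cast Nat.mod_lt _ (by omega)
  have hy0 : 0 ≤ ((t.val % M₀ : ℕ) : ℝ) / M₀ := div_nonneg (Nat.cast_nonneg _) hM0.le
  have hy1 : ((t.val % M₀ : ℕ) : ℝ) / M₀ ≤ 1 := (div_le_one hM0).mpr hr.le
  have : ((M₀ : ℝ) - ((t.val % M₀ : ℕ) : ℝ)) / M₀ = 1 - ((t.val % M₀ : ℕ) : ℝ) / M₀ := by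
    rw [sub_div, div_self hM0.ne']
  rw [this]
  exact cprof_sq_add hy0 hy1

/-- LIPSCHITZ: `|gS_k(t) − gS_k(t')| ≤ (4/M₀)·dist(t − t', Nℤ)`. [folklore] -/
theorem abs_gS_sub_le (hN : 1 ≤ N) (hM : 1 ≤ M₀) (k : Fin (nC N M₀)) (t t' : Fin N) :
    |gS N M₀ k t - gS N M₀ k t'| ≤ 4 / (M₀ : ℝ) * (circAbs N ((t.val : ℤ) - (t'.val : ℤ)) : ℝ) := by
  have hM0 : (0 : ℝ) < M₀ := Nat.cast_pos.mpr (by omega)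
  unfold gS
  have h0 := cdist_nonneg hN M₀ k t
  have h0' := cdist_nonneg hN M₀ k t'
  calc |cprof (cdist N M₀ k t / M₀) - cprof (cdist N M₀ k t' / M₀)|
      ≤ 4 * |cdist N M₀ k t / M₀ - cdist N M₀ k t' / M₀| :=
        abs_cprof_sub_le (div_nonneg h0' hM0.le) (div_nonneg h0 hM0.le)
    _ = 4 / M₀ * |cdist N M₀ k t - cdist N M₀ k t'| := by
        rw [← sub_div, abs_div, abs_of_pos hM0]; ring
    _ ≤ 4 / M₀ * (circAbs N ((t.val : ℤ) - (t'.val : ℤ)) : ℝ) :=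
        mul_le_mul_of_nonneg_left (abs_cdist_sub_le hN M₀ k t t') (by positivity)

/-- The successor on `ℤ/N`: `(t + 1).val ≡ t.val + 1 (mod N)`. [folklore] -/
theorem fin_val_add_one_rep [NeZero N] (t : Fin N) :
    ∃ m : ℤ, (((t + 1 : Fin N).val : ℕ) : ℤ) = (t.val : ℤ) + 1 + (N : ℤ) * m := by
  obtain ⟨N', hN'⟩ := Nat.exists_eq_add_one_of_ne_zero (NeZero.ne N)
  subst hN'
  rw [Fin.val_add_one]
  split_ifs with h
  · refine ⟨-1, ?_⟩
    rw [h, Fin.val_last]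
    push_cast
    ring
  · exact ⟨0, by push_cast; ring⟩

/-- The circular distance to a centre after one step: `dist(t + 1, M₀k) = dist(a + 1, Nℤ)` with
`a = t − M₀k`. [folklore] -/
theorem cdist_add_one [NeZero N] (M₀ : ℕ) (k : Fin (nC N M₀)) (t : Fin N) :
    cdist N M₀ k (t + 1) = (circAbs N ((t.val : ℤ) - ((M₀ * k.val : ℕ) : ℤ) + 1) : ℝ) := by
  obtain ⟨m, hm⟩ := fin_val_add_one_rep t
  unfold cdist
  rw [hm, show (t.val : ℤ) + 1 + (N : ℤ) * m - ((M₀ * k.val : ℕ) : ℤ)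
      = ((t.val : ℤ) - ((M₀ * k.val : ℕ) : ℤ) + 1) + (N : ℤ) * m by ring, circAbs_add_mul]

/-- **SECOND DIFFERENCES `O(M₀⁻²)`** (forward form; `2M₀ ≤ N`): for every centre `k` and residue `t`,
`|gS_k(t+2) − 2gS_k(t+1) + gS_k(t)| ≤ 52/M₀²`.  Ingredients: the three-term cosine estimate
`abs_cos_second_diff_le`, the `C^{1,1}` Taylor bound `cstep_taylor` (remainder `3h²`), consecutive distances
differ by `≤ 1`, and `circAbs_three`: the discrete defect `y₂ + y₀ − 2y₁` vanishes unless the middle point is the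
centre (`σ'(0) = 0`) or the antipode (`|σ'| ≤ 6/M₀` there since `2M₀ ≤ N`).  The constant 52 is not optimised.
[folklore] -/
theorem abs_gS_second_diff_le [NeZero N] (hM : 1 ≤ M₀) (h2N : 2 * M₀ ≤ N) (k : Fin (nC N M₀))
    (t : Fin N) :
    |gS N M₀ k (t + 1 + 1) - 2 * gS N M₀ k (t + 1) + gS N M₀ k t| ≤ 52 / (M₀ : ℝ) ^ 2 := by
  have hN1 : 1 ≤ N := by omega
  have hN2 : 2 ≤ N := by omega
  have hM0 : (0 : ℝ) < M₀ := Nat.cast_pos.mpr (by omega)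
  set a : ℤ := (t.val : ℤ) - ((M₀ * k.val : ℕ) : ℤ) with ha
  have hc0 : cdist N M₀ k t = (circAbs N a : ℝ) := rfl
  have hc1 : cdist N M₀ k (t + 1) = (circAbs N (a + 1) : ℝ) := cdist_add_one M₀ k t
  have hc2 : cdist N M₀ k (t + 1 + 1) = (circAbs N (a + 2) : ℝ) := by
    rw [cdist_add_one M₀ k (t + 1)]
    obtain ⟨m, hm⟩ := fin_val_add_one_rep t
    rw [hm, show (t.val : ℤ) + 1 + (N : ℤ) * m - ((M₀ * k.val : ℕ) : ℤ) + 1 = (a + 2) + (N : ℤ) * m by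
      rw [ha]; ring, circAbs_add_mul]
  -- the three normalised distances `y_j = dist(a + j, Nℤ)/M₀`
  set y0 : ℝ := (circAbs N a : ℝ) / M₀ with hy0
  set y1 : ℝ := (circAbs N (a + 1) : ℝ) / M₀ with hy1
  set y2 : ℝ := (circAbs N (a + 2) : ℝ) / M₀ with hy2
  have hg0 : gS N M₀ k t = Real.cos (Real.pi / 2 * cstep y0) := by unfold gS cprof; rw [hc0]
  have hg1 : gS N M₀ k (t + 1) = Real.cos (Real.pi / 2 * cstep y1) := by unfold gS cprof; rw [hc1]
  have hg2 : gS N M₀ k (t + 1 + 1) = Real.cos (Real.pi / 2 * cstep y2) := by unfold gS cprof; rw [hc2]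
  have hcnn : ∀ b : ℤ, (0 : ℝ) ≤ (circAbs N b : ℝ) := fun b => by exact_mod_cast circAbs_nonneg hN1 b
  have hstep : ∀ b : ℤ, |(circAbs N (b + 1) : ℝ) - (circAbs N b : ℝ)| ≤ 1 := fun b => by
    have h1 := abs_circAbs_sub_circAbs_le hN1 (b + 1) b
    rw [show b + 1 - b = 1 by ring] at h1
    have h2 : (circAbs N 1 : ℝ) ≤ 1 := by
      have h3 := circAbs_le_abs hN1 (1 : ℤ)
      have h4 : circAbs N 1 ≤ 1 := by simpa using h3
      exact_mod_cast h4
    linarith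
  have hy00 : 0 ≤ y0 := div_nonneg (hcnn _) hM0.le
  have hy10 : 0 ≤ y1 := div_nonneg (hcnn _) hM0.le
  have hy20 : 0 ≤ y2 := div_nonneg (hcnn _) hM0.le
  set e : ℝ := 1 / (M₀ : ℝ) with he
  have he0 : 0 ≤ e := by positivity
  have hd10 : |y1 - y0| ≤ e := by
    rw [hy1, hy0, he, ← sub_div, abs_div, abs_of_pos hM0, div_le_div_iff_of_pos_right hM0]
    exact hstep a
  have hd21 : |y2 - y1| ≤ e := by
    rw [hy2, hy1, he, ← sub_div, abs_div, abs_of_pos hM0, div_le_div_iff_of_pos_right hM0]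
    have h := hstep (a + 1)
    rwa [show a + 1 + 1 = a + 2 by ring] at h
  have hpi2 : Real.pi / 2 ≤ 2 := by linarith [Real.pi_le_four]
  have hpi0 : 0 ≤ Real.pi / 2 := by positivity
  -- Taylor remainders at `y1`
  have hT2 : |cstep y2 - cstep y1 - cstepD y1 * (y2 - y1)| ≤ 3 * e ^ 2 := by
    refine (cstep_taylor hy10 hy20).trans ?_
    have : (y2 - y1) ^ 2 ≤ e ^ 2 := by
      rw [← sq_abs]; exact pow_le_pow_left₀ (abs_nonneg _) hd21 2
    linarith
  have hT0 : |cstep y0 - cstep y1 - cstepD y1 * (y0 - y1)| ≤ 3 * e ^ 2 := by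
    refine (cstep_taylor hy10 hy00).trans ?_
    have : (y0 - y1) ^ 2 ≤ e ^ 2 := by
      rw [← sq_abs, abs_sub_comm]; exact pow_le_pow_left₀ (abs_nonneg _) hd10 2
    linarith
  -- the discrete defect term
  have hdef : |cstepD y1 * (y2 + y0 - 2 * y1)| ≤ 12 * e ^ 2 := by
    rcases circAbs_three hN2 a with hA | hB | hC
    · -- no reflection inside the triple: `y2 + y0 − 2y1 = 0`
      have hA' : (circAbs N a : ℝ) + (circAbs N (a + 2) : ℝ) = 2 * (circAbs N (a + 1) : ℝ) := by
        exact_mod_cast hA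
      have hz : y2 + y0 - 2 * y1 = 0 := by
        have : y2 + y0 - 2 * y1
            = ((circAbs N (a + 2) : ℝ) + (circAbs N a : ℝ) - 2 * (circAbs N (a + 1) : ℝ)) / M₀ := by
          rw [hy2, hy0, hy1]; ring
        rw [this, show (circAbs N (a + 2) : ℝ) + (circAbs N a : ℝ) - 2 * (circAbs N (a + 1) : ℝ) = 0 by
          linarith, zero_div]
      rw [hz, mul_zero, abs_zero]
      positivity
    · -- the middle point is the centre: `σ'(0) = 0`
      have hD : cstepD y1 = 0 := by
        rw [hy1, hB]; simp [cstepD_zero]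
      rw [hD, zero_mul, abs_zero]
      positivity
    · -- the antipode: `y1 ≥ 1 − 1/M₀`, so `|σ'(y1)| ≤ 6/M₀`
      have hC' : (N : ℝ) - 2 ≤ 2 * (circAbs N (a + 1) : ℝ) := by exact_mod_cast hC
      have h2N' : 2 * (M₀ : ℝ) ≤ N := by exact_mod_cast h2N
      have hy1e : 1 - e ≤ y1 := by
        rw [hy1, he, le_div_iff₀ hM0]
        have : (1 - 1 / (M₀ : ℝ)) * M₀ = M₀ - 1 := by field_simp
        rw [this]
        linarith
      have hDle : |cstepD y1| ≤ 6 * e := by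
        have h1 := abs_cstepD_le hy10
        have h2 : 1 - min y1 1 ≤ e := by
          rcases le_or_gt y1 1 with h | h
          · rw [min_eq_left h]; linarith
          · rw [min_eq_right h.le]; linarith
        linarith
      have hsum : |y2 + y0 - 2 * y1| ≤ 2 * e := by
        calc |y2 + y0 - 2 * y1| = |(y2 - y1) + (y0 - y1)| := by
              rw [show y2 + y0 - 2 * y1 = (y2 - y1) + (y0 - y1) by ring]
          _ ≤ |y2 - y1| + |y0 - y1| := abs_add_le _ _
          _ ≤ e + e := add_le_add hd21 (by rw [abs_sub_comm]; exact hd10)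
          _ = 2 * e := by ring
      rw [abs_mul]
      calc |cstepD y1| * |y2 + y0 - 2 * y1| ≤ (6 * e) * (2 * e) :=
            mul_le_mul hDle hsum (abs_nonneg _) (by positivity)
        _ = 12 * e ^ 2 := by ring
  -- second difference of the phases `Θ_j = ½π σ(y_j)`
  have hΘ : |Real.pi / 2 * cstep y2 - 2 * (Real.pi / 2 * cstep y1) + Real.pi / 2 * cstep y0|
      ≤ 36 * e ^ 2 := by
    have hid : Real.pi / 2 * cstep y2 - 2 * (Real.pi / 2 * cstep y1) + Real.pi / 2 * cstep y0
        = Real.pi / 2 * ((cstep y2 - cstep y1 - cstepD y1 * (y2 - y1))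
            + (cstep y0 - cstep y1 - cstepD y1 * (y0 - y1)) + cstepD y1 * (y2 + y0 - 2 * y1)) := by ring
    rw [hid, abs_mul, abs_of_nonneg hpi0]
    have hin : |(cstep y2 - cstep y1 - cstepD y1 * (y2 - y1))
            + (cstep y0 - cstep y1 - cstepD y1 * (y0 - y1)) + cstepD y1 * (y2 + y0 - 2 * y1)|
        ≤ 18 * e ^ 2 :=
      (abs_add_three _ _ _).trans (by linarith)
    calc Real.pi / 2 * _ ≤ 2 * (18 * e ^ 2) := mul_le_mul hpi2 hin (abs_nonneg _) (by norm_num)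
      _ = 36 * e ^ 2 := by ring
  -- first differences of the phases
  have hCA : |Real.pi / 2 * cstep y0 - Real.pi / 2 * cstep y2| ≤ 8 * e := by
    rw [← mul_sub, abs_mul, abs_of_nonneg hpi0]
    have h1 : |cstep y0 - cstep y2| ≤ 2 * |y0 - y2| := abs_cstep_sub_le hy20 hy00
    have h2 : |y0 - y2| ≤ 2 * e := by
      calc |y0 - y2| = |(y0 - y1) + (y1 - y2)| := by rw [show y0 - y2 = (y0 - y1) + (y1 - y2) by ring]
        _ ≤ |y0 - y1| + |y1 - y2| := abs_add_le _ _
        _ ≤ e + e := add_le_add (by rw [abs_sub_comm]; exact hd10) (by rw [abs_sub_comm]; exact hd21)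
        _ = 2 * e := by ring
    calc Real.pi / 2 * |cstep y0 - cstep y2| ≤ 2 * (2 * (2 * e)) :=
          mul_le_mul hpi2 (h1.trans (by linarith)) (abs_nonneg _) (by norm_num)
      _ = 8 * e := by ring
  have hCB : |Real.pi / 2 * cstep y0 - Real.pi / 2 * cstep y1| ≤ 4 * e := by
    rw [← mul_sub, abs_mul, abs_of_nonneg hpi0]
    have h1 : |cstep y0 - cstep y1| ≤ 2 * |y0 - y1| := abs_cstep_sub_le hy10 hy00
    have h2 : |y0 - y1| ≤ e := by rw [abs_sub_comm]; exact hd10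
    calc Real.pi / 2 * |cstep y0 - cstep y1| ≤ 2 * (2 * e) :=
          mul_le_mul hpi2 (h1.trans (by linarith)) (abs_nonneg _) (by norm_num)
      _ = 4 * e := by ring
  -- assemble with the three-term cosine estimate
  rw [hg2, hg1, hg0]
  have hmain := abs_cos_second_diff_le (Real.pi / 2 * cstep y2) (Real.pi / 2 * cstep y1)
    (Real.pi / 2 * cstep y0)
  calc |Real.cos (Real.pi / 2 * cstep y2) - 2 * Real.cos (Real.pi / 2 * cstep y1)
          + Real.cos (Real.pi / 2 * cstep y0)|
      ≤ |Real.pi / 2 * cstep y2 - 2 * (Real.pi / 2 * cstep y1) + Real.pi / 2 * cstep y0|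
          + |Real.pi / 2 * cstep y0 - Real.pi / 2 * cstep y2|
            * |Real.pi / 2 * cstep y0 - Real.pi / 2 * cstep y1| / 2 := hmain
    _ ≤ 36 * e ^ 2 + (8 * e) * (4 * e) / 2 :=
        add_le_add hΘ (div_le_div_of_nonneg_right (mul_le_mul hCA hCB (abs_nonneg _) (by positivity))
          (by norm_num))
    _ = 52 / (M₀ : ℝ) ^ 2 := by rw [he]; ring

end Profile

/-! ## §4  The smooth partition functions `hS_z(x) = Π_μ gS_{z_μ}(x_μ)` on the finite torus -/

section Torus

variable {d : ℕ} (N : Fin d → ℕ)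

/-- MODEL. **The smooth partition functions** `hS_z(x) = Π_{μ=1}^d gS_{z_μ}(x_μ)`, indexed by the centres
`z ∈ Ctr N M₀` of the cube cover of `B5TorusCover` — the product structure of (1.118), with the `C^{1,1}` profile
`cprof` in place of the trapezoid of `B5TorusPartition.hz`. [cite: Balaban1984PropagatorsI, (1.118) p.36] -/
def hS (M₀ : ℕ) (z : Ctr N M₀) (x : TSite d N) : ℝ := ∏ i, gS (N i) M₀ (z i) (x i)

variable {N}

/-- `0 ≤ hS`. [folklore] -/
theorem hS_nonneg (hN : ∀ i, 1 ≤ N i) (M₀ : ℕ) (z : Ctr N M₀) (x : TSite d N) : 0 ≤ hS N M₀ z x :=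
  Finset.prod_nonneg fun i _ => gS_nonneg (hN i) M₀ (z i) (x i)

/-- `hS ≤ 1`. [folklore] -/
theorem hS_le_one (hN : ∀ i, 1 ≤ N i) (M₀ : ℕ) (z : Ctr N M₀) (x : TSite d N) : hS N M₀ z x ≤ 1 :=
  Finset.prod_le_one (fun i _ => gS_nonneg (hN i) M₀ (z i) (x i)) fun i _ => gS_le_one (z i) (x i)

/-- **(1.118) on the finite torus, smooth version: `Σ_z hS_z(x)² = 1` exactly**, for all periods divisible by
`M₀` and `≥ 2M₀` (the product of the one-dimensional identities `sum_gS_sq`). [cite: Balaban1984PropagatorsI, (1.118) p.36] -/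
theorem sum_hS_sq {M₀ : ℕ} (hM : 1 ≤ M₀) (hdiv : ∀ i, M₀ ∣ N i) (h2N : ∀ i, 2 * M₀ ≤ N i)
    (x : TSite d N) : ∑ z : Ctr N M₀, hS N M₀ z x ^ 2 = 1 := by
  unfold hS
  simp_rw [← Finset.prod_pow]
  rw [← Fintype.prod_sum (fun i (k : Fin (nC (N i) M₀)) => gS (N i) M₀ k (x i) ^ 2)]
  exact Finset.prod_eq_one fun i _ => sum_gS_sq hM (hdiv i) (h2N i) (x i)

/-- **Support of `hS_z`** (radius `M₀`, half that of `B5TorusPartition.hz`): `hS_z(x) = 0` once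
`tdist x (ctr z) ≥ M₀`. [cite: Balaban1984PropagatorsI, (1.118) p.36 (supp h_z ⊂ □_z)] -/
theorem hS_eq_zero_of_le (hN : ∀ i, 1 ≤ N i) {M₀ : ℕ} (hM : 1 ≤ M₀) {z : Ctr N M₀} {x : TSite d N}
    (h : (M₀ : ℝ) ≤ tdist N x (ctr hN M₀ z)) : hS N M₀ z x = 0 := by
  rcases (Finset.univ : Finset (Fin d)).eq_empty_or_nonempty with he | hne
  · exfalso
    have h0 : tdist N x (ctr hN M₀ z) = 0 := by
      unfold tdist
      rw [he, Finset.sup_empty, bot_eq_zero, Nat.cast_zero]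
    have hM1 : (1 : ℝ) ≤ M₀ := by exact_mod_cast hM
    linarith
  · obtain ⟨i, -, hi⟩ := Finset.exists_mem_eq_sup Finset.univ hne (ccoord N x (ctr hN M₀ z))
    have h1 : tdist N x (ctr hN M₀ z) = cdist (N i) M₀ (z i) (x i) := by
      rw [← ccoord_ctr_eq hN M₀ z x i]
      unfold tdist
      rw [hi]
    rw [h1] at h
    exact Finset.prod_eq_zero (Finset.mem_univ i) (gS_eq_zero_of_le hM h)

/-- **`hS_z` is `(4d/M₀)`-Lipschitz in the torus distance.** [cite: Balaban1984PropagatorsI, (1.118) p.36 with (1.121) p.37] -/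
theorem abs_hS_sub_le (hN : ∀ i, 1 ≤ N i) {M₀ : ℕ} (hM : 1 ≤ M₀) (z : Ctr N M₀) (x x' : TSite d N) :
    |hS N M₀ z x - hS N M₀ z x'| ≤ 4 * d / M₀ * tdist N x x' := by
  have hM0 : (0 : ℝ) < M₀ := by exact_mod_cast hM
  unfold hS
  calc |∏ i, gS (N i) M₀ (z i) (x i) - ∏ i, gS (N i) M₀ (z i) (x' i)|
      ≤ ∑ i, |gS (N i) M₀ (z i) (x i) - gS (N i) M₀ (z i) (x' i)| :=
        abs_prod_sub_prod_le _ _ _ (fun i _ => ⟨gS_nonneg (hN i) M₀ (z i) (x i), gS_le_one (z i) (x i)⟩)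
          fun i _ => ⟨gS_nonneg (hN i) M₀ (z i) (x' i), gS_le_one (z i) (x' i)⟩
    _ ≤ ∑ _i : Fin d, 4 / M₀ * tdist N x x' := by
        apply Finset.sum_le_sum
        intro i _
        calc |gS (N i) M₀ (z i) (x i) - gS (N i) M₀ (z i) (x' i)|
            ≤ 4 / M₀ * (circAbs (N i) (((x i).val : ℤ) - ((x' i).val : ℤ)) : ℝ) :=
              abs_gS_sub_le (hN i) hM (z i) _ _
          _ ≤ 4 / M₀ * tdist N x x' :=
              mul_le_mul_of_nonneg_left (circAbs_le_tdist hN x x' i) (div_nonneg (by norm_num) hM0.le)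
    _ = 4 * d / M₀ * tdist N x x' := by
        rw [Finset.sum_const, Finset.card_univ, Fintype.card_fin, nsmul_eq_mul]
        ring

/-- Splitting off the factor of coordinate `μ`. [folklore] -/
theorem hS_eq (M₀ : ℕ) (z : Ctr N M₀) (x : TSite d N) (μ : Fin d) :
    hS N M₀ z x = gS (N μ) M₀ (z μ) (x μ) * ∏ i ∈ Finset.univ.erase μ, gS (N i) M₀ (z i) (x i) :=
  (Finset.mul_prod_erase _ (fun i => gS (N i) M₀ (z i) (x i)) (Finset.mem_univ μ)).symm

/-- Changing coordinate `μ` only changes the factor `μ`. [folklore] -/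
theorem hS_update (M₀ : ℕ) (z : Ctr N M₀) (x : TSite d N) (μ : Fin d) (v : Fin (N μ)) :
    hS N M₀ z (Function.update x μ v)
      = gS (N μ) M₀ (z μ) v * ∏ i ∈ Finset.univ.erase μ, gS (N i) M₀ (z i) (x i) := by
  rw [hS_eq M₀ z _ μ, Function.update_self]
  congr 1
  exact Finset.prod_congr rfl fun i hi => by rw [Function.update_of_ne (Finset.ne_of_mem_erase hi)]

/-- **SECOND DIFFERENCES OF `hS_z` ALONG EVERY AXIS ARE `O(M₀⁻²)`** (forward form): for every centre `z`, site
`x` and axis `μ`, `|hS_z(x + 2e_μ) − 2hS_z(x + e_μ) + hS_z(x)| ≤ 52/M₀²` — the datum the `(Δh)A` term of (1.121)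
consumes (`Δ^η` is a sum over axes of second differences).  [cite: Balaban1984PropagatorsI, (1.121) p.37] -/
theorem abs_hS_second_diff_le [∀ i, NeZero (N i)] {M₀ : ℕ} (hM : 1 ≤ M₀) (h2N : ∀ i, 2 * M₀ ≤ N i)
    (z : Ctr N M₀) (x : TSite d N) (μ : Fin d) :
    |hS N M₀ z (Function.update x μ (x μ + 1 + 1)) - 2 * hS N M₀ z (Function.update x μ (x μ + 1))
        + hS N M₀ z x| ≤ 52 / (M₀ : ℝ) ^ 2 := by
  have hN : ∀ i, 1 ≤ N i := UT.one_le N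
  rw [hS_update, hS_update, hS_eq M₀ z x μ]
  set R := ∏ i ∈ Finset.univ.erase μ, gS (N i) M₀ (z i) (x i) with hR
  have hR0 : 0 ≤ R := Finset.prod_nonneg fun i _ => gS_nonneg (hN i) M₀ (z i) (x i)
  have hR1 : R ≤ 1 :=
    Finset.prod_le_one (fun i _ => gS_nonneg (hN i) M₀ (z i) (x i)) fun i _ => gS_le_one (z i) (x i)
  have hid : gS (N μ) M₀ (z μ) (x μ + 1 + 1) * R - 2 * (gS (N μ) M₀ (z μ) (x μ + 1) * R)
        + gS (N μ) M₀ (z μ) (x μ) * R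
      = (gS (N μ) M₀ (z μ) (x μ + 1 + 1) - 2 * gS (N μ) M₀ (z μ) (x μ + 1) + gS (N μ) M₀ (z μ) (x μ)) * R := by
    ring
  rw [hid, abs_mul, abs_of_nonneg hR0]
  calc _ ≤ 52 / (M₀ : ℝ) ^ 2 * 1 :=
        mul_le_mul (abs_gS_second_diff_le hM (h2N μ) (z μ) (x μ)) hR1 hR0 (by positivity)
    _ = 52 / (M₀ : ℝ) ^ 2 := mul_one _

end Torus

/-! ## §5  Realisation: the operators `HS_z` on `ℓ²(ι)` and the located fields of (1.118)/(1.121) -/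

section Realisation

variable {d : ℕ} (N : Fin d → ℕ) {ι : Type*}

/-- The smooth partition functions on the metric carrier `UT N` of `B5TorusCover`. [cite: Balaban1984PropagatorsI, (1.118) p.36] -/
def hSU (M₀ : ℕ) (z : Ctr N M₀) (x : UT N) : ℝ := hS N M₀ z (UT.toSite N x)

/-- **The operators `h_z` of (1.119)–(1.123) in the smooth model**: multiplication by `hS_z ∘ π` on `ℓ²(ι)` for a
component index type `ι` fibred over the torus by `π` (same shape as `B5TorusPartition.Hop`). [cite: Balaban1984PropagatorsI, (1.118)–(1.119) p.36] -/
def HSop (M₀ : ℕ) (π : ι → UT N) (z : Ctr N M₀) : Module.End ℝ (EuclideanSpace ℝ ι) :=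
  mulOp fun i => hSU N M₀ z (π i)

/-- Each `HSop z` is symmetric (the field `symmH` of `B5Local114.Realisation`). [cite: Balaban1984PropagatorsI, (1.119) p.36] -/
theorem symmHS_holds [Fintype ι] (M₀ : ℕ) (π : ι → UT N) :
    ∀ (z : Ctr N M₀) (u v : EuclideanSpace ℝ ι), inner ℝ (HSop N M₀ π z u) v = inner ℝ u (HSop N M₀ π z v) :=
  fun _ u v => inner_mulOp_left _ u v

variable [∀ i, NeZero (N i)]

omit [∀ i, NeZero (N i)] in
/-- **The field `h118` of `B5Local114.Realisation`, DISCHARGED by the smooth partition**: `Σ_z H z * H z = 1` for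
`H := HSop N M₀ π`, all periods divisible by `M₀` and `≥ 2M₀`, every fibring `π`. [cite: Balaban1984PropagatorsI, (1.118) p.36] -/
theorem h118S_holds {M₀ : ℕ} (hM : 1 ≤ M₀) (hdiv : ∀ i, M₀ ∣ N i) (h2N : ∀ i, 2 * M₀ ≤ N i) (π : ι → UT N) :
    ∑ z : Ctr N M₀, HSop N M₀ π z * HSop N M₀ π z = 1 :=
  sum_mulOp_mul_self _ fun i => sum_hS_sq hM hdiv h2N (UT.toSite N (π i))

/-- `‖HSop z v‖ ≤ ‖v‖`. [folklore] -/
theorem norm_HSop_le [Fintype ι] (M₀ : ℕ) (π : ι → UT N) (z : Ctr N M₀) (v : EuclideanSpace ℝ ι) :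
    ‖HSop N M₀ π z v‖ ≤ ‖v‖ := by
  have ha : ∀ i, |hSU N M₀ z (π i)| ≤ 1 := fun i => by
    unfold hSU
    rw [abs_of_nonneg (hS_nonneg (UT.one_le N) M₀ z _)]
    exact hS_le_one (UT.one_le N) M₀ z _
  have h := norm_mulOp_le (a := fun i => hSU N M₀ z (π i)) zero_le_one ha v
  rw [one_mul] at h
  exact h

/-- **Support of `HSop z`** (radius `M₀`): if `v` vanishes at every component whose base point is within distance
`< M₀` of the centre `z`, then `HSop z v = 0`. [cite: Balaban1984PropagatorsI, (1.118) p.36 (supp h_z ⊂ □_z)] -/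
theorem HSop_eq_zero_of_far {M₀ : ℕ} (hM : 1 ≤ M₀) (π : ι → UT N) (z : Ctr N M₀) (v : EuclideanSpace ℝ ι)
    (h : ∀ i, dist (π i) (ctrU N M₀ z) < M₀ → v i = 0) : HSop N M₀ π z v = 0 := by
  apply mulOp_eq_zero_of_vanish
  intro i hi
  apply h i
  by_contra hfar
  exact hi (hS_eq_zero_of_le (UT.one_le N) hM (not_lt.mp hfar))

/-- **`hS_z` is `(4d/M₀)`-Lipschitz on the carrier** (first differences `∇h_z = O(M₀⁻¹)`, the `∂h`-terms of
(1.121)/(1.128)). [cite: Balaban1984PropagatorsI, (1.121) p.37, (1.128) p.38] -/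
theorem hSU_lipschitz {M₀ : ℕ} (hM : 1 ≤ M₀) (z : Ctr N M₀) (x x' : UT N) :
    |hSU N M₀ z x - hSU N M₀ z x'| ≤ 4 * d / M₀ * dist x x' :=
  abs_hS_sub_le (UT.one_le N) hM z _ _

/-- **Second differences of `hS_z` along every axis are `≤ 52/M₀²` on the carrier** (the `(Δh)A` datum of
(1.121)). [cite: Balaban1984PropagatorsI, (1.121) p.37] -/
theorem hSU_second_diff {M₀ : ℕ} (hM : 1 ≤ M₀) (h2N : ∀ i, 2 * M₀ ≤ N i) (z : Ctr N M₀) (x : UT N)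
    (μ : Fin d) :
    |hSU N M₀ z (UT.ofSite N (Function.update (UT.toSite N x) μ (UT.toSite N x μ + 1 + 1)))
        - 2 * hSU N M₀ z (UT.ofSite N (Function.update (UT.toSite N x) μ (UT.toSite N x μ + 1)))
        + hSU N M₀ z x| ≤ 52 / (M₀ : ℝ) ^ 2 :=
  abs_hS_second_diff_le hM h2N z (UT.toSite N x) μ

/-- `0 ≤ hS_z ≤ 1` on the carrier. [folklore] -/
theorem hSU_mem_Icc (M₀ : ℕ) (z : Ctr N M₀) (x : UT N) : hSU N M₀ z x ∈ Set.Icc (0 : ℝ) 1 :=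
  ⟨hS_nonneg (UT.one_le N) M₀ z _, hS_le_one (UT.one_le N) M₀ z _⟩

omit [∀ i, NeZero (N i)] in
/-- **`Σ_z hS_z(x)² = 1` on the carrier** (= (1.118)). [cite: Balaban1984PropagatorsI, (1.118) p.36] -/
theorem sum_hSU_sq {M₀ : ℕ} (hM : 1 ≤ M₀) (hdiv : ∀ i, M₀ ∣ N i) (h2N : ∀ i, 2 * M₀ ≤ N i) (x : UT N) :
    ∑ z : Ctr N M₀, hSU N M₀ z x ^ 2 = 1 :=
  sum_hS_sq hM hdiv h2N _

end Realisation

/-! ## §6  The Schur schema of (1.126) ⟹ (1.128) for the smooth partition (`B5Commutator128.h128_schema`) -/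

section Commutator

variable {ι : Type} [Fintype ι] {d : ℕ} {N : Fin d → ℕ} [∀ i, NeZero (N i)]

/-- **(1.128) for the smooth partition, kernel part discharged** — `B5Commutator128.h128_schema` instantiated with
`a z i := hS_z(π i)` (support radius `s := M₀`, Lipschitz constant `ℓ := 4d/M₀`): GIVEN the split
`Δ_a = kerOp l + kerOp k` with `l` of range `ρ` and normed local commutator bound `ℓ₁` ((1.121) — for the smooth
partition the `(Δh)A` contribution to `ℓ₁` is `O(M₀⁻²)·(fine steps)… = O(M₀⁻¹)` uniformly in `η` by
`hSU_second_diff`, cf. the module docstring) and the decay (1.126) of `k`, the bound (1.128) holds with rate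
`twoDelta0 δ M₀` and constant `ℓ₁e^{4+ρ/M₀} + (4d/M₀)·C·(24/(eδ))·Λ·e⁷`. [cite: Balaban1984PropagatorsI, (1.128) p.38] -/
theorem h128S_torus {M₀ : ℕ} (hM : 1 ≤ M₀) (π : ι → UT N)
    {l k : ι → ι → ℝ} {Dg : Module.End ℝ (EuclideanSpace ℝ ι)} {ℓ₁ ρ C δ Λ : ℝ}
    (range : ∀ i j, ρ < dist (π i) (π j) → l i j = 0)
    (local_norm : ∀ z A, ‖(HSop N M₀ π z * kerOp l - kerOp l * HSop N M₀ π z) A‖ ≤ ℓ₁ * (‖Dg A‖ + ‖A‖))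
    (hℓ₁ : 0 ≤ ℓ₁) (decay : ∀ i j, |k i j| ≤ C * Real.exp (-(δ * dist (π i) (π j)))) (hC : 0 ≤ C)
    (hδ : 0 < δ) (rowsum : ∀ i, ∑ j, Real.exp (-(δ / 8 * dist (π i) (π j))) ≤ Λ)
    (z₁ z₂ : Ctr N M₀) (A : EuclideanSpace ℝ ι) :
    ‖HSop N M₀ π z₁ (Kop (kerOp l + kerOp k) (HSop N M₀ π) z₂ A)‖
      ≤ (ℓ₁ * Real.exp (4 + ρ / M₀) + 4 * d / M₀ * C * (24 / (Real.exp 1 * δ)) * Λ * Real.exp 7)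
        * Real.exp (-(twoDelta0 δ M₀ * dist (ctrU N M₀ z₁) (ctrU N M₀ z₂))) * (‖Dg A‖ + ‖A‖) := by
  have hM' : (0 : ℝ) < M₀ := by exact_mod_cast hM
  have hS : Schema π (fun z i => hSU N M₀ z (π i)) (ctrU N M₀) l k Dg
      (M₀) (4 * d / M₀) ℓ₁ ρ C δ Λ :=
    { abs_le := fun z i => by
        have h := hSU_mem_Icc N M₀ z (π i)
        rw [abs_of_nonneg h.1]
        exact h.2
      supp := fun z i hne => by
        by_contra hfar
        exact hne (hS_eq_zero_of_le (UT.one_le N) hM (le_of_lt (not_le.mp hfar)))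
      lip := fun z i j => hSU_lipschitz N hM z (π i) (π j)
      lip_nonneg := by positivity
      range := range
      local_norm := local_norm
      loc_nonneg := hℓ₁
      decay := decay
      C_nonneg := hC
      δ_pos := hδ
      rowsum := rowsum }
  exact h128_schema hS hM' (by linarith) z₁ z₂ A

/-- **(1.128) for the smooth partition with the row sum discharged through a base map with fibres `≤ m`**
(`B5Commutator128.rowsum_fibre_le`): the only remaining hypotheses are the split/local bound (1.121) and the
decay (1.126). [cite: Balaban1984PropagatorsI, (1.128) p.38] -/
theorem h128S_torus_fibre {M₀ : ℕ} (hM : 1 ≤ M₀) (π : ι → UT N) {m : ℕ}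
    (hm : ∀ y : UT N, ((Finset.univ.filter fun j : ι => π j = y).card : ℝ) ≤ m)
    {l k : ι → ι → ℝ} {Dg : Module.End ℝ (EuclideanSpace ℝ ι)} {ℓ₁ ρ C δ : ℝ}
    (range : ∀ i j, ρ < dist (π i) (π j) → l i j = 0)
    (local_norm : ∀ z A, ‖(HSop N M₀ π z * kerOp l - kerOp l * HSop N M₀ π z) A‖ ≤ ℓ₁ * (‖Dg A‖ + ‖A‖))
    (hℓ₁ : 0 ≤ ℓ₁) (decay : ∀ i j, |k i j| ≤ C * Real.exp (-(δ * dist (π i) (π j)))) (hC : 0 ≤ C)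
    (hδ : 0 < δ) (z₁ z₂ : Ctr N M₀) (A : EuclideanSpace ℝ ι) :
    ‖HSop N M₀ π z₁ (Kop (kerOp l + kerOp k) (HSop N M₀ π) z₂ A)‖
      ≤ (ℓ₁ * Real.exp (4 + ρ / M₀)
          + 4 * d / M₀ * C * (24 / (Real.exp 1 * δ)) * (m * B4Sect5Proof.latticeConst d (δ / 8)) * Real.exp 7)
        * Real.exp (-(twoDelta0 δ M₀ * dist (ctrU N M₀ z₁) (ctrU N M₀ z₂))) * (‖Dg A‖ + ‖A‖) :=
  h128S_torus hM π range local_norm hℓ₁ decay hC hδ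
    (fun i => rowsum_fibre_le π hm (by positivity) i) z₁ z₂ A

end Commutator

end

end Literature.MathematicalPhysics.QuantumFieldTheory.Balaban1983to89.B5SmoothPartition
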